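import Literature.Algebra.Polynomial.CasasAlvero.Degree5CharP
import HarnessLib

/-!
# Casas-Alvero in degree 5 fails in characteristics 131, 193, 599 and 8009

Explicit prime-field-rational Casas-Alvero quintics in depressed normal form `X^5 + a X^3 + b X^2 + c X` with prime-field witnesses, found by the
structured search `d5search2.py` of the seat-2 g4 packet (parametrise by the shared roots `r` of `D³f = 10X² + a` and `s` of `D²f = 10X³ + 3aX + b`,
solve for `a, b, c`, filter): together with `Degree5CharP.lean` (3, 7, 11) and `PrimePowSuccCounterexample.lean` (2) this makes EIGHT of the nine bad
primes 2, 3, 7, 11, 131, 193, 599, 3541, 8009 of degree 5 [Castryck–Laterveer–Ounaïes 2012, Thm. 4] Lean theorems in the strong form "fails over EVERY field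
of that characteristic"; the ninth, `3541`, is `Degree5Char3541.lean` (same search: `X^5 - 10X^3 + 9X^2`).  ERRATUM: earlier revisions of this
docstring listed `1451` in place of `3541` and reported that the search finds no `𝔽_1451`-rational example — correctly so, because `1451` is NOT a
bad prime: `CA_5` holds over every field of characteristic `1451` (`Degree5.lean`, `holdsInDegree_five_of_charP`).
[cite: CastryckLaterveerOunaies2012, Sec. 1]
-/

noncomputable section

open Polynomial

namespace Literature.Algebra.Polynomial.CasasAlvero

variable (K : Type*) [Field K]

/-- the depressed quintic normal form `X^5 + a X^3 + b X^2 + c X`. [folklore] -/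
def quinticNF (a b c : K) : K[X] := X ^ 5 + (a • X ^ 3 + b • X ^ 2 + c • X ^ 1)

/-- its degree is 5. [folklore] -/
theorem natDegree_quinticNF (a b c : K) : (quinticNF K a b c).natDegree = 5 := by
  have h3 : (a • (X : K[X]) ^ 3 + b • X ^ 2 + c • X ^ 1).natDegree ≤ 3 := by
    refine (natDegree_add_le _ _).trans (max_le ((natDegree_add_le _ _).trans (max_le ?_ ?_)) ?_)
    · exact (natDegree_smul_le _ _).trans (by simp)
    · exact (natDegree_smul_le _ _).trans (by simp)
    · exact (natDegree_smul_le _ _).trans (by simp)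
  unfold quinticNF
  rw [natDegree_add_eq_left_of_natDegree_lt (by rw [natDegree_X_pow]; omega), natDegree_X_pow]

/-- it is monic. [folklore] -/
theorem monic_quinticNF (a b c : K) : (quinticNF K a b c).Monic := by
  have h3 : (a • (X : K[X]) ^ 3 + b • X ^ 2 + c • X ^ 1).natDegree ≤ 3 := by
    refine (natDegree_add_le _ _).trans (max_le ((natDegree_add_le _ _).trans (max_le ?_ ?_)) ?_)
    · exact (natDegree_smul_le _ _).trans (by simp)
    · exact (natDegree_smul_le _ _).trans (by simp)
    · exact (natDegree_smul_le _ _).trans (by simp)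
  unfold quinticNF
  apply (monic_X_pow 5).add_of_left
  refine lt_of_le_of_lt (degree_le_of_natDegree_le h3) ?_
  rw [degree_X_pow]; exact_mod_cast (by norm_num : (3 : ℕ) < 5)

/-- a depressed quintic that is a pure fifth power `(X - w)^5` has `w = 0` (evaluate at `0`). [folklore] -/
theorem eq_zero_of_quinticNF_eq_pow {a b c w : K} (h : quinticNF K a b c = (X - C w) ^ 5) : w = 0 := by
  have h0 := congrArg (eval 0) h
  simp only [quinticNF, eval_add, eval_pow, eval_X, eval_sub, eval_C, zero_sub, eval_smul, smul_eq_mul] at h0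
  norm_num at h0
  have := (pow_eq_zero_iff (by norm_num : 5 ≠ 0)).mp h0.symm
  exact neg_eq_zero.mp this

/-- a Casas-Alvero depressed quintic with `a + b + c ≠ 0` (so it is not `X^5`) refutes CA₅ over `K`. [folklore] -/
theorem not_holdsInDegree_five_of_quinticNF {a b c : K} (hCA : IsCasasAlvero (quinticNF K a b c)) (habc : a + b + c ≠ 0) :
    ¬ HoldsInDegree K 5 := by
  intro h
  obtain ⟨w, hw⟩ := h _ (monic_quinticNF K _ _ _) (natDegree_quinticNF K _ _ _) hCA
  have hw0 := eq_zero_of_quinticNF_eq_pow K hw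
  subst hw0
  have h1 := congrArg (eval 1) hw
  simp only [quinticNF, eval_add, eval_pow, eval_X, map_zero, sub_zero, one_pow, eval_smul, smul_eq_mul, mul_one] at h1
  exact habc (by linear_combination h1)

section Char131
variable [CharP K 131]

/-- `X^5 + (-10) X^3 + (20) X^2 + (-11) X` is Casas-Alvero in characteristic 131 (witness roots D¹↦30, D²↦1, D³↦1, D⁴↦0). [cite: CastryckLaterveerOunaies2012, Sec. 1] -/
theorem isCasasAlvero_quintic_char_131 : IsCasasAlvero (quinticNF K (-10) (20) (-11)) := by
  have hp : (131 : K) = 0 := by simpa using CharP.cast_eq_zero K 131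
  intro i hi0 hi
  rw [natDegree_quinticNF] at hi
  unfold quinticNF
  interval_cases i
  · refine ⟨(30 : K), ?_, ?_⟩
    · simp only [eval_add, eval_pow, eval_X, eval_smul, smul_eq_mul]
      linear_combination (183570 : K) * hp
    · simp only [map_add, map_smul, hasseDeriv_X_pow, eval_add, eval_mul, eval_C, eval_pow, eval_X, eval_smul, smul_eq_mul,
        show Nat.choose 5 1 = 5 from rfl, show Nat.choose 3 1 = 3 from rfl, show Nat.choose 2 1 = 2 from rfl, show Nat.choose 1 1 = 1 from rfl]
      push_cast
      linear_combination (30719 : K) * hp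
  · refine ⟨(1 : K), ?_, ?_⟩
    · simp only [eval_add, eval_pow, eval_X, eval_smul, smul_eq_mul]
      linear_combination (0 : K) * hp
    · simp only [map_add, map_smul, hasseDeriv_X_pow, eval_add, eval_mul, eval_C, eval_pow, eval_X, eval_smul, smul_eq_mul,
        show Nat.choose 5 2 = 10 from rfl, show Nat.choose 3 2 = 3 from rfl, show Nat.choose 2 2 = 1 from rfl, show Nat.choose 1 2 = 0 from rfl]
      push_cast
      linear_combination (0 : K) * hp
  · refine ⟨(1 : K), ?_, ?_⟩
    · simp only [eval_add, eval_pow, eval_X, eval_smul, smul_eq_mul]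
      linear_combination (0 : K) * hp
    · simp only [map_add, map_smul, hasseDeriv_X_pow, eval_add, eval_mul, eval_C, eval_pow, eval_X, eval_smul, smul_eq_mul,
        show Nat.choose 5 3 = 10 from rfl, show Nat.choose 3 3 = 1 from rfl, show Nat.choose 2 3 = 0 from rfl, show Nat.choose 1 3 = 0 from rfl]
      push_cast
      linear_combination (0 : K) * hp
  · refine ⟨(0 : K), ?_, ?_⟩
    · simp only [eval_add, eval_pow, eval_X, eval_smul, smul_eq_mul]
      linear_combination (0 : K) * hp
    · simp only [map_add, map_smul, hasseDeriv_X_pow, eval_add, eval_mul, eval_C, eval_pow, eval_X, eval_smul, smul_eq_mul,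
        show Nat.choose 5 4 = 5 from rfl, show Nat.choose 3 4 = 0 from rfl, show Nat.choose 2 4 = 0 from rfl, show Nat.choose 1 4 = 0 from rfl]
      push_cast
      linear_combination (0 : K) * hp

end Char131

section Char193
variable [CharP K 193]

/-- `X^5 + (0) X^3 + (-10) X^2 + (9) X` is Casas-Alvero in characteristic 193 (witness roots D¹↦-76, D²↦1, D³↦0, D⁴↦0). [cite: CastryckLaterveerOunaies2012, Sec. 1] -/
theorem isCasasAlvero_quintic_char_193 : IsCasasAlvero (quinticNF K (0) (-10) (9)) := by
  have hp : (193 : K) = 0 := by simpa using CharP.cast_eq_zero K 193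
  intro i hi0 hi
  rw [natDegree_quinticNF] at hi
  unfold quinticNF
  interval_cases i
  · refine ⟨(-76 : K), ?_, ?_⟩
    · simp only [eval_add, eval_pow, eval_X, eval_smul, smul_eq_mul]
      linear_combination (-13137740 : K) * hp
    · simp only [map_add, map_smul, hasseDeriv_X_pow, eval_add, eval_mul, eval_C, eval_pow, eval_X, eval_smul, smul_eq_mul,
        show Nat.choose 5 1 = 5 from rfl, show Nat.choose 3 1 = 3 from rfl, show Nat.choose 2 1 = 2 from rfl, show Nat.choose 1 1 = 1 from rfl]
      push_cast
      linear_combination (864313 : K) * hp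
  · refine ⟨(1 : K), ?_, ?_⟩
    · simp only [eval_add, eval_pow, eval_X, eval_smul, smul_eq_mul]
      linear_combination (0 : K) * hp
    · simp only [map_add, map_smul, hasseDeriv_X_pow, eval_add, eval_mul, eval_C, eval_pow, eval_X, eval_smul, smul_eq_mul,
        show Nat.choose 5 2 = 10 from rfl, show Nat.choose 3 2 = 3 from rfl, show Nat.choose 2 2 = 1 from rfl, show Nat.choose 1 2 = 0 from rfl]
      push_cast
      linear_combination (0 : K) * hp
  · refine ⟨(0 : K), ?_, ?_⟩
    · simp only [eval_add, eval_pow, eval_X, eval_smul, smul_eq_mul]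
      linear_combination (0 : K) * hp
    · simp only [map_add, map_smul, hasseDeriv_X_pow, eval_add, eval_mul, eval_C, eval_pow, eval_X, eval_smul, smul_eq_mul,
        show Nat.choose 5 3 = 10 from rfl, show Nat.choose 3 3 = 1 from rfl, show Nat.choose 2 3 = 0 from rfl, show Nat.choose 1 3 = 0 from rfl]
      push_cast
      linear_combination (0 : K) * hp
  · refine ⟨(0 : K), ?_, ?_⟩
    · simp only [eval_add, eval_pow, eval_X, eval_smul, smul_eq_mul]
      linear_combination (0 : K) * hp
    · simp only [map_add, map_smul, hasseDeriv_X_pow, eval_add, eval_mul, eval_C, eval_pow, eval_X, eval_smul, smul_eq_mul,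
        show Nat.choose 5 4 = 5 from rfl, show Nat.choose 3 4 = 0 from rfl, show Nat.choose 2 4 = 0 from rfl, show Nat.choose 1 4 = 0 from rfl]
      push_cast
      linear_combination (0 : K) * hp

end Char193

section Char599
variable [CharP K 599]

/-- `X^5 + (-10) X^3 + (16) X^2 + (-7) X` is Casas-Alvero in characteristic 599 (witness roots D¹↦1, D²↦-268, D³↦1, D⁴↦0). [cite: CastryckLaterveerOunaies2012, Sec. 1] -/
theorem isCasasAlvero_quintic_char_599 : IsCasasAlvero (quinticNF K (-10) (16) (-7)) := by
  have hp : (599 : K) = 0 := by simpa using CharP.cast_eq_zero K 599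
  intro i hi0 hi
  rw [natDegree_quinticNF] at hi
  unfold quinticNF
  interval_cases i
  · refine ⟨(1 : K), ?_, ?_⟩
    · simp only [eval_add, eval_pow, eval_X, eval_smul, smul_eq_mul]
      linear_combination (0 : K) * hp
    · simp only [map_add, map_smul, hasseDeriv_X_pow, eval_add, eval_mul, eval_C, eval_pow, eval_X, eval_smul, smul_eq_mul,
        show Nat.choose 5 1 = 5 from rfl, show Nat.choose 3 1 = 3 from rfl, show Nat.choose 2 1 = 2 from rfl, show Nat.choose 1 1 = 1 from rfl]
      push_cast
      linear_combination (0 : K) * hp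
  · refine ⟨(-268 : K), ?_, ?_⟩
    · simp only [eval_add, eval_pow, eval_X, eval_smul, smul_eq_mul]
      linear_combination (-2307737012 : K) * hp
    · simp only [map_add, map_smul, hasseDeriv_X_pow, eval_add, eval_mul, eval_C, eval_pow, eval_X, eval_smul, smul_eq_mul,
        show Nat.choose 5 2 = 10 from rfl, show Nat.choose 3 2 = 3 from rfl, show Nat.choose 2 2 = 1 from rfl, show Nat.choose 1 2 = 0 from rfl]
      push_cast
      linear_combination (-321336 : K) * hp
  · refine ⟨(1 : K), ?_, ?_⟩
    · simp only [eval_add, eval_pow, eval_X, eval_smul, smul_eq_mul]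
      linear_combination (0 : K) * hp
    · simp only [map_add, map_smul, hasseDeriv_X_pow, eval_add, eval_mul, eval_C, eval_pow, eval_X, eval_smul, smul_eq_mul,
        show Nat.choose 5 3 = 10 from rfl, show Nat.choose 3 3 = 1 from rfl, show Nat.choose 2 3 = 0 from rfl, show Nat.choose 1 3 = 0 from rfl]
      push_cast
      linear_combination (0 : K) * hp
  · refine ⟨(0 : K), ?_, ?_⟩
    · simp only [eval_add, eval_pow, eval_X, eval_smul, smul_eq_mul]
      linear_combination (0 : K) * hp
    · simp only [map_add, map_smul, hasseDeriv_X_pow, eval_add, eval_mul, eval_C, eval_pow, eval_X, eval_smul, smul_eq_mul,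
        show Nat.choose 5 4 = 5 from rfl, show Nat.choose 3 4 = 0 from rfl, show Nat.choose 2 4 = 0 from rfl, show Nat.choose 1 4 = 0 from rfl]
      push_cast
      linear_combination (0 : K) * hp

end Char599

section Char8009
variable [CharP K 8009]

/-- `X^5 + (-10) X^3 + (2108) X^2 + (-2099) X` is Casas-Alvero in characteristic 8009 (witness roots D¹↦-3667, D²↦-676, D³↦1, D⁴↦0). [cite: CastryckLaterveerOunaies2012, Sec. 1] -/
theorem isCasasAlvero_quintic_char_8009 : IsCasasAlvero (quinticNF K (-10) (2108) (-2099)) := by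
  have hp : (8009 : K) = 0 := by simpa using CharP.cast_eq_zero K 8009
  intro i hi0 hi
  rw [natDegree_quinticNF] at hi
  unfold quinticNF
  interval_cases i
  · refine ⟨(-3667 : K), ?_, ?_⟩
    · simp only [eval_add, eval_pow, eval_X, eval_smul, smul_eq_mul]
      linear_combination (-82789624840048 : K) * hp
    · simp only [map_add, map_smul, hasseDeriv_X_pow, eval_add, eval_mul, eval_C, eval_pow, eval_X, eval_smul, smul_eq_mul,
        show Nat.choose 5 1 = 5 from rfl, show Nat.choose 3 1 = 3 from rfl, show Nat.choose 2 1 = 2 from rfl, show Nat.choose 1 1 = 1 from rfl]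
      push_cast
      linear_combination (112884717196 : K) * hp
  · refine ⟨(-676 : K), ?_, ?_⟩
    · simp only [eval_add, eval_pow, eval_X, eval_smul, smul_eq_mul]
      linear_combination (-17625551476 : K) * hp
    · simp only [map_add, map_smul, hasseDeriv_X_pow, eval_add, eval_mul, eval_C, eval_pow, eval_X, eval_smul, smul_eq_mul,
        show Nat.choose 5 2 = 10 from rfl, show Nat.choose 3 2 = 3 from rfl, show Nat.choose 2 2 = 1 from rfl, show Nat.choose 1 2 = 0 from rfl]
      push_cast
      linear_combination (-385708 : K) * hp
  · refine ⟨(1 : K), ?_, ?_⟩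
    · simp only [eval_add, eval_pow, eval_X, eval_smul, smul_eq_mul]
      linear_combination (0 : K) * hp
    · simp only [map_add, map_smul, hasseDeriv_X_pow, eval_add, eval_mul, eval_C, eval_pow, eval_X, eval_smul, smul_eq_mul,
        show Nat.choose 5 3 = 10 from rfl, show Nat.choose 3 3 = 1 from rfl, show Nat.choose 2 3 = 0 from rfl, show Nat.choose 1 3 = 0 from rfl]
      push_cast
      linear_combination (0 : K) * hp
  · refine ⟨(0 : K), ?_, ?_⟩
    · simp only [eval_add, eval_pow, eval_X, eval_smul, smul_eq_mul]
      linear_combination (0 : K) * hp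
    · simp only [map_add, map_smul, hasseDeriv_X_pow, eval_add, eval_mul, eval_C, eval_pow, eval_X, eval_smul, smul_eq_mul,
        show Nat.choose 5 4 = 5 from rfl, show Nat.choose 3 4 = 0 from rfl, show Nat.choose 2 4 = 0 from rfl, show Nat.choose 1 4 = 0 from rfl]
      push_cast
      linear_combination (0 : K) * hp

end Char8009

/-- CA₅ FAILS over every field of characteristic 131, 193, 599 or 8009 (four of the nine bad primes of degree 5; 2, 3, 7, 11 are
`not_holdsInDegree_five_of_char_two/_three/_seven/_eleven`). [cite: CastryckLaterveerOunaies2012, Sec. 1] -/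
theorem not_holdsInDegree_five_of_charP_large (p : ℕ) [CharP K p] (hp : p = 131 ∨ p = 193 ∨ p = 599 ∨ p = 8009) :
    ¬ HoldsInDegree K 5 := by
  rcases hp with rfl | rfl | rfl | rfl
  · exact not_holdsInDegree_five_of_quinticNF K (isCasasAlvero_quintic_char_131 K) (by norm_num)
  · exact not_holdsInDegree_five_of_quinticNF K (isCasasAlvero_quintic_char_193 K) (by norm_num)
  · exact not_holdsInDegree_five_of_quinticNF K (isCasasAlvero_quintic_char_599 K) (by norm_num)
  · exact not_holdsInDegree_five_of_quinticNF K (isCasasAlvero_quintic_char_8009 K) (by norm_num)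

end Literature.Algebra.Polynomial.CasasAlvero
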